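import Summits.Ventures.HodgeRepro2.T5CyclotomicHeckeCommutative

/-!
# FOR EVERY ODD PRIME `ℓ`: the degrees of all the cells and the tree recursion of the record's spherical Hecke
# algebra at every inert place of `ℚ(ζ_ℓ)⁺`, with `q = p^{o/2}` explicit

Tier-5 support N3 / §G-N4.2 (seat p3, gen 79). File 271 reads the cells and the recursion of the record's own pair
on the field of record with `q = p^{gcd(o,3)}`; file 273 gives `N(v) = p^{o/2}` at every place of `ℚ(ζ_ℓ)⁺` above a
prime of even order `o` modulo `ℓ`, for every odd `ℓ`. This file reads file 251's datum-free cells theorem there: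

* **`exists_cells_ncard_and_three_term_record_cyclotomic_of_even`** — cells `gₙ ∈ U(1 ⊗ H₀)` with
  `deg Tₙ = (q³ + 1) q^{4n−3}` (`n ≥ 1`), `deg T₀ = 1`, `T₁ T_{n+2} = T_{n+3} + (q − 1) T_{n+2} + q⁴ T_{n+1}` and
  `T₁² = T₂ + (q − 1) T₁ + (q⁴ + q) T₀` (`k` of characteristic `0`), `q = p^{o/2}`, at every place `v` of `ℚ(ζ_ℓ)⁺`
  above a prime `p ≠ ℓ` of even order `o` modulo `ℓ`.

§8(d): uses an L-value-free non-vanishing device: NO.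
-/

open Matrix NumberField NumberField.IsCMField IsDedekindDomain IsDedekindDomain.HeightOneSpectrum Module Polynomial
  MulAction
open scoped TensorProduct Pointwise
open Summit.Ventures.HodgeRepro2.T5UnitaryGroupForm Summit.Ventures.HodgeRepro2.T5UnitaryHeckeAdjoint
  Summit.Ventures.HodgeRepro2.T5HeckePermutationModule Summit.Ventures.HodgeRepro2.T5HeckeDoubleCoset
  Summit.Ventures.HodgeRepro2.T5RecordHyperspecial Summit.Ventures.HodgeRepro2.T5GlobalLatticeAlmostAll
  Summit.Ventures.HodgeRepro2.T5FinitePlaceSplitClassification Summit.Ventures.HodgeRepro2.T5RecordSatakeIntrinsic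
  Summit.Ventures.HodgeRepro2.T5CMFieldSquareDatum Summit.Ventures.HodgeRepro2.T5RecordSatakeToy
  Summit.Ventures.HodgeRepro2.T5RecordSatakeDegreeIntrinsic
  Summit.Ventures.HodgeRepro2.T5RecordSatakeRecurrenceIntrinsic
  Summit.Ventures.HodgeRepro2.T5SplitPlaceUnitaryGroup Summit.Ventures.HodgeRepro2.T5NonSplitPlaceUnitaryGroup
  Summit.Ventures.HodgeRepro2.T5FinitePlaceCM Summit.Ventures.HodgeRepro2.T5StarOfInvolution
  Summit.Ventures.HodgeRepro2.T5RecordSatake Summit.Ventures.HodgeRepro2.T5RecordSatakeInert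
  Summit.Ventures.HodgeRepro2.T5RecordSatakeCell Summit.Ventures.HodgeRepro2.T5RecordSatakeDegree
  Summit.Ventures.HodgeRepro2.T5RecordSatakeRecurrence Summit.Ventures.HodgeRepro2.T5RecordSatakeInertToyDegree
  Summit.Ventures.HodgeRepro2.T5RecordSatakeDegreeCells Summit.Ventures.HodgeRepro2.T5CyclotomicSevenHeckeCommutative
  Summit.Ventures.HodgeRepro2.T5CyclotomicStaysPrimeIffEven Summit.Ventures.HodgeRepro2.T5CyclotomicHeckeCommutative

namespace Summit.Ventures.HodgeRepro2.T5RecordSatakeCyclotomicCells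

section Record

variable (ℓ : ℕ) [hℓ : Fact ℓ.Prime] (h2 : 2 < ℓ)
variable (K : Type*) [Field K] [CharZero K] [IsCyclotomicExtension {ℓ} ℚ K]
variable (p : ℕ) [hp : Fact p.Prime] (hn : p.Coprime ℓ)
variable (v : HeightOneSpectrum (𝓞 (maximalRealSubfield K))) [hv : v.asIdeal.LiesOver (Ideal.span {(p : ℤ)})]
include h2 hn hv

/-- **THE DEGREES OF ALL THE CELLS AND THE TREE RECURSION AT EVERY INERT PLACE OF `ℚ(ζ_ℓ)⁺`, `q = p^{o/2}`**
(file 251's datum-free theorem with file 273's `N(v) = p^{o/2}`): for every family `l` of generators of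
`𝓞_{ℚ(ζ_ℓ)}` over `𝓞_{ℚ(ζ_ℓ)⁺}` and every field `k` of characteristic `0`, cells `gₙ ∈ U(1 ⊗ H₀)` with
`#(K_v gₙ K_v / K_v) = (q³ + 1) q^{4n−3}` (`n ≥ 1`), `#(K_v g₀ K_v / K_v) = 1`, and `Tₙ := 1_{K_v gₙ K_v}` satisfying
`T₁ T_{n+2} = T_{n+3} + (q − 1) T_{n+2} + q⁴ T_{n+1}` and `T₁² = T₂ + (q − 1) T₁ + (q⁴ + q) T₀`. -/
theorem exists_cells_ncard_and_three_term_record_cyclotomic_of_even (heven : Even (orderOf (p : ZMod ℓ)))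
    (k : Type*) [Field k] [CharZero k] {r : ℕ} (l : Fin r → 𝓞 K)
    (hl : Submodule.span (𝓞 (maximalRealSubfield K)) (Set.range l) = ⊤) :
    haveI := numberFieldCyc ℓ K; haveI := isCMFieldCyc ℓ h2 K
    ∃ g : ℕ → (letI := tensorStarRing K v; ↥(formUnitaryGroup (tensorGram K v (gramToy K)))),
      (∀ n, 1 ≤ n → (orbit (recordHyperspecial K v l (gramToy K))
        (g n : _ ⧸ recordHyperspecial K v l (gramToy K))).ncard =
          ((p ^ (orderOf (p : ZMod ℓ) / 2)) ^ 3 + 1) * (p ^ (orderOf (p : ZMod ℓ) / 2)) ^ (4 * n - 3)) ∧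
      (orbit (recordHyperspecial K v l (gramToy K))
        (g 0 : _ ⧸ recordHyperspecial K v l (gramToy K))).ncard = 1 ∧
      ∃ hfin : ∀ n, Finite (orbit (recordHyperspecial K v l (gramToy K))
          (g n : _ ⧸ recordHyperspecial K v l (gramToy K))),
        (∀ n, letI := hfin 1; letI := hfin (n + 1 + 1); letI := hfin (n + 1 + 1 + 1); letI := hfin (n + 1);
          doubleCosetOp k (recordHyperspecial K v l (gramToy K)) (g 1) *
              doubleCosetOp k (recordHyperspecial K v l (gramToy K)) (g (n + 1 + 1)) =
            doubleCosetOp k (recordHyperspecial K v l (gramToy K)) (g (n + 1 + 1 + 1)) +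
              ((p : k) ^ (orderOf (p : ZMod ℓ) / 2) - 1) •
                doubleCosetOp k (recordHyperspecial K v l (gramToy K)) (g (n + 1 + 1)) +
              ((p : k) ^ (orderOf (p : ZMod ℓ) / 2)) ^ 4 •
                doubleCosetOp k (recordHyperspecial K v l (gramToy K)) (g (n + 1))) ∧
        (letI := hfin 1; letI := hfin (0 + 1); letI := hfin (0 + 1 + 1); letI := hfin 0;
          doubleCosetOp k (recordHyperspecial K v l (gramToy K)) (g 1) *
              doubleCosetOp k (recordHyperspecial K v l (gramToy K)) (g (0 + 1)) =
            doubleCosetOp k (recordHyperspecial K v l (gramToy K)) (g (0 + 1 + 1)) +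
              ((p : k) ^ (orderOf (p : ZMod ℓ) / 2) - 1) •
                doubleCosetOp k (recordHyperspecial K v l (gramToy K)) (g (0 + 1)) +
              (((p : k) ^ (orderOf (p : ZMod ℓ) / 2)) ^ 4 + (p : k) ^ (orderOf (p : ZMod ℓ) / 2)) •
                doubleCosetOp k (recordHyperspecial K v l (gramToy K)) (g 0)) := by
  haveI := numberFieldCyc ℓ K
  haveI := isCMFieldCyc ℓ h2 K
  refine ((exists_map_eq_iff_even ℓ h2 K p hn v).mpr heven).elim fun w hmap => ?_
  have hN := absNorm_eq_pow_of_even ℓ h2 K p hn v w (hw := liesOver_of_map_eq K v w hmap) heven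
  have e1 : ((Ideal.absNorm v.asIdeal : k) - 1) = (p : k) ^ (orderOf (p : ZMod ℓ) / 2) - 1 := by
    rw [hN, Nat.cast_pow]
  have e2 : (Ideal.absNorm v.asIdeal : k) ^ 4 = ((p : k) ^ (orderOf (p : ZMod ℓ) / 2)) ^ 4 := by
    rw [hN, Nat.cast_pow]
  have e3 : (Ideal.absNorm v.asIdeal : k) ^ 4 + Ideal.absNorm v.asIdeal =
      ((p : k) ^ (orderOf (p : ZMod ℓ) / 2)) ^ 4 + (p : k) ^ (orderOf (p : ZMod ℓ) / 2) := by
    rw [hN, Nat.cast_pow]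
  have key := @exists_cells_three_term_and_ncard_record_of_staysPrime' K _ (numberFieldCyc ℓ K) (isCMFieldCyc ℓ h2 K)
    v w (liesOver_of_map_eq K v w hmap) hmap _ l k _ _ hl _ gramToy_isHermitian isUnit_det_gramToy
    (notMem_badSet_gramToy _)
  obtain ⟨g, hdeg, hdeg0, hfin, h1, h2'⟩ := key
  exact ⟨g, fun n hn' => (hdeg n hn').trans (by rw [hN]), hdeg0, hfin,
    fun n => three_term_congr e1 e2 (h1 n), three_term_congr e1 e3 h2'⟩

end Record

end Summit.Ventures.HodgeRepro2.T5RecordSatakeCyclotomicCells
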